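import Summits.ResolutionOfSingularities.ResolutionOfSingularities.Theorems.FrobeniusClosingPatchingRelPerfectConeDepthConeChartsOff
import HarnessLib

/-!
# Crux `PatchingRelPerfect` (stmt-ResolutionOfSingularities-16161), chain W5.2 — rung «r-smooth-quadric-ℓ», local algebra: a
# quadratic form `Q(c)` with SMOOTH reduced quadric `V(Q̄) ⊂ ℙ³_κ` on the charts of `Bl_𝔪 Spec R` — its strict transform has
# simple normal crossings with the exceptional divisor at EVERY prime over `𝔪` (Jacobian criterion, arbitrary coefficients)

[OURS · L1 W5.2 · rung tool] Replaces the role of NO printed item; NOT a statement of the manuscript under review; fact-free,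
any characteristic, any residue field, arbitrary coefficients.  AI-written (AI review is weaker than expert review).

`R` regular local with regular system of parameters `c₀, …, c₃` (`(c) = 𝔪`, `μ(𝔪) = 4`), `Q ∈ R[T₀, …, T₃]` a form of degree
`2`, `q = Q(c)`.  On the chart `B_i` of `Bl_𝔪 Spec R` (`e_j = c_j/c_i`, `e_i = 1`): `φ(q) = φ(c_i)² · f_i` with `f_i = Q(e)`
(`chartForm`; the tree's `reesChartBase_eval_eq_pow_mul_eval₂`), and modulo the exceptional parameter `f_i ≡ F_i(T)` with
`F_i = Q̄(T)|_{T_i = 1} ∈ κ[T_j : j ≠ i]` (`chartPoly`, `coneε_chartPoly`).  HYPOTHESIS (smoothness of the reduced quadric on the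
chart): `(F_i, ∂F_i/∂T_j : j ≠ i) = (1)` in `κ[T_j : j ≠ i]`.  THEN at every prime `𝔓` over `𝔪` the members of `{φ(c_i), f_i}`
lying in `𝔓` are part of one regular system of parameters of `(B_i)_𝔓` (`smoothQuadChart`: some `∂F_i/∂T_j ∉ 𝔓̄`, then
`isRsopPart_kill_hypersurface`), and `f_i ≠ φ(c_i)` (`chartForm_ne_chartBase`).  This generalises `quadChart` (the split quadric
`c₀c₁ + c₂c₃`, a graph on every chart) to ARBITRARY coefficients: it covers the non-split nondegenerate quadrics
`c₀c₁ + N(c₂, c₃)` (`N` an anisotropic binary form) and the anisotropic quaternary forms, for which no chart is a graph over `κ`.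

## References
* H. Matsumura, *Commutative Ring Theory*, CUP 1986, Thm. 14.2, Thm. 30.3 (Jacobian criterion). [Matsumura1987]
* The Stacks Project, Tags 0804, 0BIQ (charts of a blowing up, `B_i/(c_i) ≅ (R/I)[T]`). [StacksProject]
* J. Kollár, *Lectures on Resolution of Singularities* (2007), Def. 3.24, 3.61. [Kollar2007]
-/

set_option linter.dupNamespace false

noncomputable section

open CategoryTheory CategoryTheory.Limits AlgebraicGeometry TopologicalSpace IsLocalRing
open Literature.AlgebraicGeometry.Resolution
open Scheme.IdealSheafData
open scoped Pointwise

namespace Summit.ResolutionOfSingularities.ResolutionOfSingularities.Theorems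

universe u

namespace ConeDepth

/-! ## The reduced chart polynomial of a form (pure polynomial algebra over a local ring) -/

section ChartPoly

variable {R : Type u} [CommRing R] [IsLocalRing R] (Q : MvPolynomial (Fin 4) R) (i : Fin 4)

/-- Killing the variable `T_i` (`T_i ↦ 1`, `T_j ↦ T_j` for `j ≠ i`) with residue-field coefficients. [folklore] -/
def killVar (j : Fin 4) : MvPolynomial {j : Fin 4 // j ≠ i} (ResidueField R) :=
  if h : j = i then 1 else MvPolynomial.X ⟨j, h⟩

/-- **The reduced chart polynomial** `F_i = Q̄(T)|_{T_i = 1} ∈ κ[T_j : j ≠ i]` of a form `Q ∈ R[T₀, …, T₃]`: reduce the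
coefficients to the residue field and kill `T_i`. [cite: StacksProject, Tag 0BIQ] -/
def chartPoly : MvPolynomial {j : Fin 4 // j ≠ i} (ResidueField R) :=
  MvPolynomial.aeval (killVar i) (MvPolynomial.map (residue R) Q)

/-- `chartPoly` is a ring homomorphism in `Q`. [folklore] -/
theorem chartPoly_eq_comp : chartPoly Q i =
    ((MvPolynomial.aeval (killVar (R := R) i)).toRingHom.comp (MvPolynomial.map (residue R))) Q := rfl

/-- **Base change of the reduced chart polynomial** along a local homomorphism `g : R → R'`: `F_i(Q^g) = F_i(Q)^{ḡ}`. [folklore] -/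
theorem chartPoly_map {R' : Type u} [CommRing R'] [IsLocalRing R'] (g : R →+* R') [IsLocalHom g] :
    chartPoly (MvPolynomial.map g Q) i = MvPolynomial.map (ResidueField.map g) (chartPoly Q i) := by
  have h : ((MvPolynomial.aeval (killVar (R := R') i)).toRingHom.comp (MvPolynomial.map (residue R'))).comp
        (MvPolynomial.map g) =
      (MvPolynomial.map (ResidueField.map g)).comp
        ((MvPolynomial.aeval (killVar (R := R) i)).toRingHom.comp (MvPolynomial.map (residue R))) := by
    refine MvPolynomial.ringHom_ext (fun r => ?_) (fun j => ?_)
    · show MvPolynomial.aeval (killVar i) (MvPolynomial.map (residue R') (MvPolynomial.map g (MvPolynomial.C r))) =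
        MvPolynomial.map (ResidueField.map g) (MvPolynomial.aeval (killVar i) (MvPolynomial.map (residue R) (MvPolynomial.C r)))
      rw [MvPolynomial.map_C, MvPolynomial.map_C, MvPolynomial.algHom_C, MvPolynomial.algebraMap_eq, MvPolynomial.map_C,
        MvPolynomial.algHom_C, MvPolynomial.algebraMap_eq, MvPolynomial.map_C]
      rfl
    · show MvPolynomial.aeval (killVar i) (MvPolynomial.map (residue R') (MvPolynomial.map g (MvPolynomial.X j))) =
        MvPolynomial.map (ResidueField.map g) (MvPolynomial.aeval (killVar i) (MvPolynomial.map (residue R) (MvPolynomial.X j)))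
      rw [MvPolynomial.map_X, MvPolynomial.map_X, MvPolynomial.aeval_X, MvPolynomial.map_X, MvPolynomial.aeval_X, killVar, killVar]
      split_ifs with h
      · rw [map_one]
      · rw [MvPolynomial.map_X]
  exact RingHom.congr_fun h Q

/-- Base change of the smoothness certificate `(F_i, ∂F_i) = (1)` along a local homomorphism. [cite: Matsumura1987, Thm. 30.3] -/
theorem span_chartPoly_pderiv_eq_top_map {R' : Type u} [CommRing R'] [IsLocalRing R'] (g : R →+* R') [IsLocalHom g]
    (hsm : Ideal.span (insert (chartPoly Q i) (Set.range fun t => MvPolynomial.pderiv t (chartPoly Q i))) = ⊤) :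
    Ideal.span (insert (chartPoly (MvPolynomial.map g Q) i)
      (Set.range fun t => MvPolynomial.pderiv t (chartPoly (MvPolynomial.map g Q) i))) = ⊤ := by
  have h := congrArg (Ideal.map (MvPolynomial.map (ResidueField.map g))) hsm
  rw [Ideal.map_top, Ideal.map_span, Set.image_insert_eq, ← Set.range_comp] at h
  have hfun : (fun t => MvPolynomial.pderiv t (chartPoly (MvPolynomial.map g Q) i)) =
      (MvPolynomial.map (ResidueField.map g)) ∘ (fun t => MvPolynomial.pderiv t (chartPoly Q i)) := by
    funext t
    rw [Function.comp_apply, chartPoly_map, MvPolynomial.pderiv_map]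
  rw [hfun, chartPoly_map]
  exact h

end ChartPoly

/-! ## The form on the charts of `Bl_𝔪 Spec R`, `R` regular local of dimension four -/

section SmoothQuadric

variable {R : Type u} [CommRing R] [IsRegularLocalRing R] (Q : MvPolynomial (Fin 4) R) (c : Fin 4 → R)
  (hz : Ideal.span (Set.range c) = maximalIdeal R) (hd : (maximalIdeal R).spanFinrank = 4) (i : Fin 4)

local notation3 "Bc" => chartRing c i
local notation3 "φc" => chartBase c i
local notation3 "ec[" j "]" => chartGen c i j

/-- **The form on the chart**: `f_i = Q(e)` (with `e_i = 1`), so that `φ(Q(c)) = φ(c_i)^{deg Q} · f_i`. [folklore] -/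
def chartForm : Bc := MvPolynomial.eval₂Hom (chartBase c i) (fun j => ec[j]) Q

omit [IsRegularLocalRing R] in
/-- **`φ(q) = φ(c_i)² · f_i`** for `q = Q(c)`, `Q` a form of degree `2` (the tree's `reesChartBase_eval_eq_pow_mul_eval₂`).
[cite: StacksProject, Tag 052P] -/
theorem chartBase_eval_eq (hQ : Q.IsHomogeneous 2) : φc (MvPolynomial.eval c Q) = φc (c i) ^ 2 * chartForm Q c i :=
  reesChartBase_eval_eq_pow_mul_eval₂ c i hQ

include hz hd in
/-- `coneε` kills `T_i`: `coneε(killVar_i j) = ē_j`. [folklore] -/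
theorem coneε_killVar (j : Fin 4) : coneε c hz hd i (killVar i j) = Ideal.Quotient.mk _ (ec[j]) := by
  unfold killVar
  split_ifs with h
  · subst h
    rw [map_one, show chartGen c j j = 1 from chartGen_self c j, map_one]
  · exact coneε_X c hz hd i ⟨j, h⟩

include hz hd in
/-- **`f_i ≡ F_i(e)` modulo the exceptional parameter**: `coneε(F_i) = f̄_i`. [cite: StacksProject, Tag 0BIQ] -/
theorem coneε_chartPoly : coneε c hz hd i (chartPoly Q i) = Ideal.Quotient.mk _ (chartForm Q c i) := by
  have h : (coneε c hz hd i).toRingHom.comp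
        ((MvPolynomial.aeval (killVar (R := R) i)).toRingHom.comp (MvPolynomial.map (residue R))) =
      (Ideal.Quotient.mk (Ideal.span {φc (c i)})).comp (MvPolynomial.eval₂Hom (chartBase c i) (fun j => ec[j])) := by
    refine MvPolynomial.ringHom_ext (fun r => ?_) (fun j => ?_)
    · show coneε c hz hd i (MvPolynomial.aeval (killVar i) (MvPolynomial.map (residue R) (MvPolynomial.C r))) =
        Ideal.Quotient.mk _ (MvPolynomial.eval₂Hom (chartBase c i) (fun j => ec[j]) (MvPolynomial.C r))
      rw [MvPolynomial.map_C, MvPolynomial.algHom_C, MvPolynomial.algebraMap_eq, MvPolynomial.eval₂Hom_C]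
      exact coneε_C c hz hd i r
    · show coneε c hz hd i (MvPolynomial.aeval (killVar i) (MvPolynomial.map (residue R) (MvPolynomial.X j))) =
        Ideal.Quotient.mk _ (MvPolynomial.eval₂Hom (chartBase c i) (fun j => ec[j]) (MvPolynomial.X j))
      rw [MvPolynomial.map_X, MvPolynomial.aeval_X, MvPolynomial.eval₂Hom_X']
      exact coneε_killVar c hz hd i j
  exact RingHom.congr_fun h Q

variable (𝔓 : Ideal (chartRing c i)) [𝔓.IsPrime] (h𝔓 : 𝔓.comap (chartBase c i) = maximalIdeal R)
  (L : Type u) [CommRing L] [IsLocalRing L] [Algebra (chartRing c i) L] [IsLocalization.AtPrime L 𝔓]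

include hz hd h𝔓 in
/-- **The smooth quadric chart**: if the reduced chart polynomial is smooth, `(F_i, ∂F_i/∂T_j : j ≠ i) = (1)`, then at every prime
`𝔓` over `𝔪` the members of `{φ(c_i), f_i}` lying in `𝔓` are part of one regular system of parameters of `L = (B_i)_𝔓`: some
`∂F_i/∂T_j` does not vanish at `𝔓̄`, and the Jacobian criterion `isRsopPart_kill_hypersurface` applies (no generator killed).
[cite: Matsumura1987, Thm. 14.2, Thm. 30.3] -/
theorem smoothQuadChart
    (hsm : Ideal.span (insert (chartPoly Q i) (Set.range fun t => MvPolynomial.pderiv t (chartPoly Q i))) = ⊤) :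
    ∃ (n : ℕ) (v : Fin n → L)
      (ι : {g : chartRing c i // g ∈ [chartBase c i (c i), chartForm Q c i] ∧ g ∈ 𝔓} → Fin n),
      IsRsopPart v ∧ Function.Injective ι ∧ ∀ g, v (ι g) = (algebraMap (chartRing c i) L : chartRing c i →+* L) g.1 := by
  classical
  haveI : IsNoetherianRing Bc := isNoetherianRing_blowupChart c i
  by_cases hf : chartForm Q c i ∈ 𝔓
  · -- on the host: the prime `𝔓̄ ⊂ κ[T_j : j ≠ i]` below `𝔓/(φ c_i)` misses some partial derivative
    have hci : φc (c i) ∈ 𝔓 := map_centre_mem' c hz (chartBase c i) 𝔓 h𝔓 i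
    have hK : Ideal.span {φc (c i)} ≤ 𝔓 := (Ideal.span_singleton_le_iff_mem _).mpr hci
    haveI := isPrime_map_mk 𝔓 _ hK
    set 𝔓bar : Ideal (MvPolynomial {j : Fin 4 // j ≠ i} (ResidueField R)) :=
      (𝔓.map (Ideal.Quotient.mk (Ideal.span {φc (c i)}))).comap (coneε c hz hd i).toRingHom with h𝔓bar
    have hbar_ne : 𝔓bar ≠ ⊤ := Ideal.comap_ne_top _ (Ideal.IsPrime.ne_top inferInstance)
    have hmem_bar : ∀ G : MvPolynomial {j : Fin 4 // j ≠ i} (ResidueField R), ∀ g : Bc,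
        coneε c hz hd i G = Ideal.Quotient.mk _ g → (G ∈ 𝔓bar ↔ g ∈ 𝔓) := by
      intro G g hG
      rw [h𝔓bar, Ideal.mem_comap, RingEquiv.toRingHom_eq_coe, RingHom.coe_coe, hG, ← Ideal.mem_comap,
        Ideal.comap_map_of_surjective _ Ideal.Quotient.mk_surjective, ← RingHom.ker_eq_comap_bot, Ideal.mk_ker,
        sup_eq_left.mpr hK]
    have hFmem : chartPoly Q i ∈ 𝔓bar := (hmem_bar _ _ (coneε_chartPoly Q c hz hd i)).mpr hf
    obtain ⟨t, ht⟩ : ∃ t, MvPolynomial.pderiv t (chartPoly Q i) ∉ 𝔓bar := by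
      by_contra h
      simp only [not_exists, not_not] at h
      refine hbar_ne (eq_top_iff.mpr ?_)
      rw [← hsm, Ideal.span_le]
      rintro G (rfl | ⟨t, rfl⟩)
      · exact hFmem
      · exact h t
    have hF0 : chartPoly Q i ≠ 0 := fun h => ht (by rw [h, map_zero]; exact zero_mem _)
    obtain ⟨a₀, ha₀⟩ := Ideal.Quotient.mk_surjective (I := Ideal.span {φc (c i)})
      (coneε c hz hd i (MvPolynomial.pderiv t (chartPoly Q i)))
    have ha₀P : a₀ ∉ 𝔓 := fun h => ht ((hmem_bar _ _ ha₀.symm).mpr h)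
    -- the Jacobian criterion with no generator killed
    let σ := {j : {j : Fin 4 // j ≠ i} // j ∉ {j : {j : Fin 4 // j ≠ i} | j ∈ ([] : List {j : Fin 4 // j ≠ i})}}
    let emb : {j : Fin 4 // j ≠ i} → σ := fun j => ⟨j, fun h => by simp at h⟩
    have hemb : Function.Injective emb := fun j j' h => by simpa [emb] using congrArg Subtype.val h
    have hval : (Subtype.val ∘ emb) = id := rfl
    let F : MvPolynomial σ (ResidueField R) := MvPolynomial.rename emb (chartPoly Q i)
    have hvalF : MvPolynomial.rename Subtype.val F = chartPoly Q i := by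
      rw [MvPolynomial.rename_rename, hval, MvPolynomial.rename_id, AlgHom.id_apply]
    have hfF : coneε c hz hd i (MvPolynomial.rename Subtype.val F) = Ideal.Quotient.mk _ (chartForm Q c i) := by
      rw [hvalF, coneε_chartPoly]
    have hF0' : F ≠ 0 := fun h => hF0 (MvPolynomial.rename_injective emb hemb (by rw [map_zero]; exact h))
    have hGa : coneε c hz hd i (MvPolynomial.rename Subtype.val (MvPolynomial.pderiv (emb t) F)) =
        Ideal.Quotient.mk _ a₀ := by
      rw [MvPolynomial.pderiv_rename hemb, MvPolynomial.rename_rename, hval, MvPolynomial.rename_id, AlgHom.id_apply, ha₀]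
    have hrs : IsRsopPart (consFamily c i L (chartBase c i) (killFamily i (chartGen c i) [] (chartForm Q c i))) :=
      isRsopPart_kill_hypersurface c i hz L (chartBase c i) (chartGen c i)
        (reesChartBase_mem_nonZeroDivisors (c i) (Ideal.mem_span_range_self (f := c) (x := i)))
        (coneε c hz hd i) (coneε_X c hz hd i) 𝔓 h𝔓 [] List.nodup_nil (by simp) (chartForm Q c i) hf F hF0' hfF (emb t) a₀
        hGa ha₀P
    exact rsopAdapted_of_consFamily_killFamily c i 𝔓 L [] (chartForm Q c i) hrs _ (fun g hg _ => by
      simp only [List.mem_cons, List.not_mem_nil, or_false] at hg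
      rcases hg with rfl | rfl
      · exact Or.inl rfl
      · exact Or.inr (Or.inr rfl))
  · -- off the host: only the exceptional parameter
    have hrs := isRsopPart_chartFamily_cone c hz hd i 𝔓 h𝔓 L (a := 0) (fun k => k.elim0)
      (Function.injective_of_subsingleton _) (fun k => k.elim0)
    exact rsopAdapted_of_chartFamily c i 𝔓 L _ hrs _ (fun g hg hgP => by
      simp only [List.mem_cons, List.not_mem_nil, or_false] at hg
      rcases hg with rfl | rfl
      · exact Or.inl rfl
      · exact absurd hgP hf)

omit [IsRegularLocalRing R] in
/-- A smooth reduced chart polynomial is non-zero. [folklore] -/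
theorem chartPoly_ne_zero_of_smooth [IsLocalRing R]
    (hsm : Ideal.span (insert (chartPoly Q i) (Set.range fun t => MvPolynomial.pderiv t (chartPoly Q i))) = ⊤) :
    chartPoly Q i ≠ 0 := by
  intro h
  rw [h] at hsm
  have hle : Ideal.span (insert (0 : MvPolynomial {j : Fin 4 // j ≠ i} (ResidueField R))
      (Set.range fun t => MvPolynomial.pderiv t (0 : MvPolynomial {j : Fin 4 // j ≠ i} (ResidueField R)))) ≤ ⊥ := by
    rw [Ideal.span_le]
    rintro G (rfl | ⟨t, rfl⟩)
    · exact zero_mem _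
    · simp
  rw [hsm, top_le_iff] at hle
  exact bot_ne_top hle

include hz hd in
/-- `f_i ≠ φ(c_i)` as soon as `F_i ≠ 0` (in particular for a smooth reduced chart polynomial). [folklore] -/
theorem chartForm_ne_chartBase (hF : chartPoly Q i ≠ 0) : chartForm Q c i ≠ φc (c i) := by
  intro h
  have hfF := coneε_chartPoly Q c hz hd i
  rw [h, mk_chartBase_self, map_eq_zero_iff _ (coneε c hz hd i).injective] at hfF
  exact hF hfF

end SmoothQuadric

end ConeDepth

end Summit.ResolutionOfSingularities.ResolutionOfSingularities.Theorems

end
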